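import Summits.ValiantsHypothesis.ValiantsHypothesis.Theorems.LacunarySymmetroidMatrixDescartesCensusPivotDefs
import Summits.ValiantsHypothesis.ValiantsHypothesis.Theorems.LacunarySymmetroidMatrixDescartesCensusPivotCruxBridge

/-!
# `MatrixDescartes` census — pivot column, normal forms: exponent shift and letter padding

HONEST FRAMING.  Bookkeeping for the object-search cell `pub-symmetroid`'s Conjecture-B column in pivot currency
(`…CensusPivotDefs.lean`; typer g8).  Two invariances of the census currency `pivotPosRoots e d J P` (distinct POSITIVE zeros of
`det (X^e • J + ∑ X^{d k} • P k)`) that every proof or search in the column uses tacitly: (1) a COMMON SHIFT of all exponents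
multiplies the determinant by a power of `X` and leaves the positive zeros unchanged (`pivotPosRoots_shift`), so rows may assume
`e = 0` or `min d = 0`; (2) PADDING with a zero letter (PSD) at any exponent changes nothing (`pivotPosRoots_snoc_zero`), so the
rows are ANTITONE in the number of letters: `pivotRootLawAt_of_succ_letters : PivotRootLawAt m (K+1) q B → PivotRootLawAt m K q B`
and `pivotRootLawAt_of_le_letters` (with `…CensusPivotBridge.pivotRootLawAt_of_le_index` the rows are thus monotone in `K` and in
the index; size monotonicity is not treated here).  Landed as a HELPER of the crux item stmt-ValiantsHypothesis-18050 with no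
closure claim; nothing here bears on `Theses.LacunarySymmetroid.MatrixDescartes`, on `KPlusLogSqLaw`, on the census registers, or
on `VP ≠ VNP`.

[folklore] `det (X^c • M) = X^{cm} det M`; a zero summand; block-diagonal determinant; reindexing.
-/

-- `Summit.ValiantsHypothesis.ValiantsHypothesis.…` repeats a component by the D-0017 layout
-- (single-conjunct summit), which the `dupNamespace` linter flags; the name is mandated.
set_option linter.dupNamespace false

namespace Summit.ValiantsHypothesis.ValiantsHypothesis.Theorems.LacunarySymmetroidMatrixDescartes.Pivot

open scoped BigOperators Matrix
open Polynomial

/-- Shifting every exponent by `c` multiplies the pivot pencil by `X^c`. [folklore] -/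
theorem pivot_pencil_shift {m K : ℕ} (e c : ℕ) (d : Fin K → ℕ) (J : Matrix (Fin m) (Fin m) ℝ)
    (P : Fin K → Matrix (Fin m) (Fin m) ℝ) :
    ((X : ℝ[X]) ^ (e + c)) • J.map Polynomial.C + ∑ k, ((X : ℝ[X]) ^ (d k + c)) • (P k).map Polynomial.C
      = ((X : ℝ[X]) ^ c) • (((X : ℝ[X]) ^ e) • J.map Polynomial.C + ∑ k, ((X : ℝ[X]) ^ d k) • (P k).map Polynomial.C) := by
  rw [smul_add, Finset.smul_sum, smul_smul, ← pow_add, add_comm c e]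
  congr 1
  refine Finset.sum_congr rfl fun k _ => ?_
  rw [smul_smul, ← pow_add, add_comm c (d k)]

/-- **Exponent shift invariance**: `pivotPosRoots (e + c) (d + c) J P = pivotPosRoots e d J P` — a common shift of all
exponents multiplies `det` by `X^{c·m}` and leaves the distinct positive zeros unchanged. [folklore] -/
theorem pivotPosRoots_shift {m K : ℕ} (e c : ℕ) (d : Fin K → ℕ) (J : Matrix (Fin m) (Fin m) ℝ)
    (P : Fin K → Matrix (Fin m) (Fin m) ℝ) :
    pivotPosRoots (e + c) (fun k => d k + c) J P = pivotPosRoots e d J P := by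
  unfold pivotPosRoots
  rw [pivot_pencil_shift, Matrix.det_smul, Fintype.card_fin]
  congr 1
  exact LiftNormalForm.posRoots_eq_of_eq_C_mul_X_pow_mul _ _ 1 (c * m) one_ne_zero (by rw [map_one, one_mul, pow_mul])

/-- Rows may assume the pivot exponent is `0` after a shift: the law at `(m,K,q,B)` bounds `pivotPosRoots (e + c) (d + c)`
through `pivotPosRoots e d`. [bookkeeping] -/
theorem pivotRootLawAt_apply_shift {m K q B : ℕ} (h : PivotRootLawAt m K q B) (e c : ℕ) (d : Fin K → ℕ)
    (J : Matrix (Fin m) (Fin m) ℝ) (P : Fin K → Matrix (Fin m) (Fin m) ℝ) (hJ : J.IsSymm) (hP : ∀ k, (P k).PosSemidef)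
    (hW : ∃ W : Matrix (Fin m) (Fin q) ℝ, (J + W * Wᵀ).PosSemidef) :
    pivotPosRoots (e + c) (fun k => d k + c) J P ≤ B := by
  rw [pivotPosRoots_shift]
  exact h e d J P hJ hP hW

/-- **Padding with a zero letter** (at any exponent `d₀`) changes nothing:
`pivotPosRoots e (Fin.snoc d d₀) J (Fin.snoc P 0) = pivotPosRoots e d J P`. [folklore] -/
theorem pivotPosRoots_snoc_zero {m K : ℕ} (e d₀ : ℕ) (d : Fin K → ℕ) (J : Matrix (Fin m) (Fin m) ℝ)
    (P : Fin K → Matrix (Fin m) (Fin m) ℝ) :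
    pivotPosRoots e (Fin.snoc d d₀ : Fin (K + 1) → ℕ) J (Fin.snoc P 0 : Fin (K + 1) → Matrix (Fin m) (Fin m) ℝ)
      = pivotPosRoots e d J P := by
  unfold pivotPosRoots
  rw [Fin.sum_univ_castSucc]
  simp only [Fin.snoc_castSucc, Fin.snoc_last, Matrix.map_zero Polynomial.C (map_zero _), smul_zero, add_zero]

/-- **Rows are antitone in the number of letters**: a law for `K + 1` PSD letters implies the law for `K` letters (pad with a
zero letter). [folklore] -/
theorem pivotRootLawAt_of_succ_letters {m K q B : ℕ} (h : PivotRootLawAt m (K + 1) q B) : PivotRootLawAt m K q B := by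
  intro e d J P hJ hP hW
  rw [← pivotPosRoots_snoc_zero e 0 d J P]
  refine h e _ J _ hJ (fun k => ?_) hW
  refine Fin.lastCases ?_ (fun i => ?_) k
  · simpa only [Fin.snoc_last] using Matrix.PosSemidef.zero
  · simpa only [Fin.snoc_castSucc] using hP i

/-- **Rows are antitone in the number of letters** (iterated): `K ≤ K' → PivotRootLawAt m K' q B → PivotRootLawAt m K q B`.
[folklore] -/
theorem pivotRootLawAt_of_le_letters {m K K' q B : ℕ} (hKK' : K ≤ K') (h : PivotRootLawAt m K' q B) :
    PivotRootLawAt m K q B := by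
  obtain ⟨r, rfl⟩ := Nat.exists_eq_add_of_le hKK'
  induction r with
  | zero => simpa using h
  | succ r ih => exact ih (Nat.le_add_right K r) (pivotRootLawAt_of_succ_letters (by simpa [Nat.add_assoc] using h))

/-! ## (3) Size: bordering with `X^e` -/

/-- Block-diagonal with a PSD block and a nonnegative scalar block is PSD. -/
theorem posSemidef_fromBlocks_diag {m : ℕ} {A : Matrix (Fin m) (Fin m) ℝ} (hA : A.PosSemidef) {a : ℝ} (ha : 0 ≤ a) :
    (Matrix.fromBlocks A 0 0 (a • (1 : Matrix (Fin 1) (Fin 1) ℝ))).PosSemidef := by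
  refine Matrix.PosSemidef.of_dotProduct_mulVec_nonneg ?_ fun x => ?_
  · have hAh := hA.isHermitian
    unfold Matrix.IsHermitian at hAh ⊢
    rw [Matrix.fromBlocks_conjTranspose, hAh]
    simp
  · rw [star_trivial]
    have hx : x = Sum.elim (x ∘ Sum.inl) (x ∘ Sum.inr) := (Sum.elim_comp_inl_inr x).symm
    rw [hx, Matrix.fromBlocks_mulVec, sumElim_dotProduct_sumElim]
    simp only [Sum.elim_comp_inl, Sum.elim_comp_inr, Matrix.zero_mulVec, add_zero, zero_add, Matrix.smul_mulVec,
      Matrix.one_mulVec, dotProduct_smul, smul_eq_mul]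
    have h1 := hA.dotProduct_mulVec_nonneg (x ∘ Sum.inl)
    rw [star_trivial] at h1
    have h2 : 0 ≤ (x ∘ Sum.inr) ⬝ᵥ (x ∘ Sum.inr) := Finset.sum_nonneg fun j _ => mul_self_nonneg _
    exact add_nonneg h1 (mul_nonneg ha h2)

/-- The size-`(m ⊕ 1)` pencil built from `J ⊕ [1]` and `P k ⊕ [0]` is block-diagonal with corner `X^e`. -/
theorem pencil_fromBlocks {m K : ℕ} (e : ℕ) (d : Fin K → ℕ) (J : Matrix (Fin m) (Fin m) ℝ)
    (P : Fin K → Matrix (Fin m) (Fin m) ℝ) :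
    ((X : ℝ[X]) ^ e) • (Matrix.fromBlocks J 0 0 (1 : Matrix (Fin 1) (Fin 1) ℝ)).map Polynomial.C
        + ∑ k, ((X : ℝ[X]) ^ d k) • (Matrix.fromBlocks (P k) 0 0 (0 : Matrix (Fin 1) (Fin 1) ℝ)).map Polynomial.C
      = Matrix.fromBlocks (((X : ℝ[X]) ^ e) • J.map Polynomial.C + ∑ k, ((X : ℝ[X]) ^ d k) • (P k).map Polynomial.C)
          0 0 (((X : ℝ[X]) ^ e) • (1 : Matrix (Fin 1) (Fin 1) ℝ[X])) := by
  ext (i | i) (j | j)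
  · simp [Matrix.sum_apply]
  · simp [Matrix.sum_apply]
  · simp [Matrix.sum_apply]
  · simp [Matrix.sum_apply, Matrix.one_apply]


/-- Transport with an explicit index witness: a `Fin`-indexed pivot law at index `q` bounds an arbitrarily indexed pivot
pencil whose pivot has index `≤ q` (`J + W Wᵀ ⪰ 0`, `W : Matrix ι (Fin q) ℝ`). [folklore] -/
theorem card_posRoots_le_of_pivotLaw_index {ι κ : Type} [Fintype ι] [DecidableEq ι] [Fintype κ] {q B : ℕ}
    (h : PivotRootLawAt (Fintype.card ι) (Fintype.card κ) q B)
    (e : ℕ) (d : κ → ℕ) (J : Matrix ι ι ℝ) (P : κ → Matrix ι ι ℝ) (hJ : J.IsSymm) (hP : ∀ k, (P k).PosSemidef)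
    (W : Matrix ι (Fin q) ℝ) (hW : (J + W * Wᵀ).PosSemidef) :
    ((Matrix.det (((X : ℝ[X]) ^ e) • J.map Polynomial.C
        + ∑ k, ((X : ℝ[X]) ^ d k) • (P k).map Polynomial.C)).roots.toFinset.filter (fun t => 0 < t)).card ≤ B := by
  classical
  set σ := Fintype.equivFin ι
  set τ := Fintype.equivFin κ
  have hJ' : (Matrix.reindex σ σ J).IsSymm := by
    unfold Matrix.IsSymm at hJ ⊢
    rw [Matrix.reindex_apply, Matrix.transpose_submatrix, hJ]
  have hP' : ∀ k, (Matrix.reindex σ σ (P (τ.symm k))).PosSemidef := fun k => by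
    rw [Matrix.reindex_apply]
    exact (hP (τ.symm k)).submatrix σ.symm
  have hW' : (Matrix.reindex σ σ J + (W.submatrix σ.symm id) * (W.submatrix σ.symm id)ᵀ).PosSemidef := by
    have hprod : (W.submatrix σ.symm id) * (W.submatrix σ.symm id)ᵀ = (W * Wᵀ).submatrix σ.symm σ.symm := by
      rw [Matrix.transpose_submatrix]
      exact Matrix.submatrix_mul_equiv W Wᵀ σ.symm (Equiv.refl (Fin q)) σ.symm
    have hadd : J.submatrix σ.symm σ.symm + (W * Wᵀ).submatrix σ.symm σ.symm = (J + W * Wᵀ).submatrix σ.symm σ.symm :=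
      rfl
    rw [hprod, Matrix.reindex_apply, hadd]
    exact hW.submatrix σ.symm
  have hb := h e (fun k => d (τ.symm k)) (Matrix.reindex σ σ J) (fun k => Matrix.reindex σ σ (P (τ.symm k))) hJ' hP'
    ⟨W.submatrix σ.symm id, hW'⟩
  unfold pivotPosRoots at hb
  rwa [det_pivot_reindex σ τ e d J P] at hb

/-- **Rows are antitone in the size**: a law at size `m + 1` implies the law at size `m` (border the pencil with the
`1 × 1` block `X^e`, i.e. `J ⊕ [1]`, `P k ⊕ [0]`, `W` padded by a zero row; `det` gains the factor `X^e`). -/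
theorem pivotRootLawAt_of_succ_size {m K q B : ℕ} (h : PivotRootLawAt (m + 1) K q B) : PivotRootLawAt m K q B := by
  intro e d J P hJ hP hW
  obtain ⟨W, hW⟩ := hW
  classical
  -- the bordered data over `Fin m ⊕ Fin 1`
  set J₁ : Matrix (Fin m ⊕ Fin 1) (Fin m ⊕ Fin 1) ℝ := Matrix.fromBlocks J 0 0 1 with hJ₁
  set P₁ : Fin K → Matrix (Fin m ⊕ Fin 1) (Fin m ⊕ Fin 1) ℝ := fun k => Matrix.fromBlocks (P k) 0 0 0 with hP₁
  set W₁ : Matrix (Fin m ⊕ Fin 1) (Fin q) ℝ := Matrix.fromRows W 0 with hW₁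
  have hJ₁s : J₁.IsSymm := by
    unfold Matrix.IsSymm at hJ ⊢
    rw [hJ₁, Matrix.fromBlocks_transpose, hJ]
    simp
  have hP₁p : ∀ k, (P₁ k).PosSemidef := fun k => by
    simpa [hP₁] using posSemidef_fromBlocks_diag (hP k) (le_refl (0 : ℝ))
  have hW₁p : (J₁ + W₁ * W₁ᵀ).PosSemidef := by
    have hWW : W₁ * W₁ᵀ = Matrix.fromBlocks (W * Wᵀ) 0 0 0 := by
      rw [hW₁, Matrix.transpose_fromRows, Matrix.fromRows_mul_fromCols]
      simp
    rw [hWW, hJ₁, Matrix.fromBlocks_add]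
    simpa using posSemidef_fromBlocks_diag hW (zero_le_one : (0 : ℝ) ≤ 1)
  -- its positive-root count equals the original one
  have hdet : Matrix.det (((X : ℝ[X]) ^ e) • J₁.map Polynomial.C + ∑ k, ((X : ℝ[X]) ^ d k) • (P₁ k).map Polynomial.C)
      = Polynomial.C 1 * (X : ℝ[X]) ^ e
        * Matrix.det (((X : ℝ[X]) ^ e) • J.map Polynomial.C + ∑ k, ((X : ℝ[X]) ^ d k) • (P k).map Polynomial.C) := by
    rw [hJ₁, hP₁, pencil_fromBlocks, Matrix.det_fromBlocks_zero₂₁, Matrix.det_smul, Matrix.det_one, Fintype.card_fin,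
      map_one]
    ring
  have hcount := LiftNormalForm.posRoots_eq_of_eq_C_mul_X_pow_mul _ _ 1 e one_ne_zero hdet
  -- transport to `Fin (m+1)` and apply the law
  have h' : PivotRootLawAt (Fintype.card (Fin m ⊕ Fin 1)) (Fintype.card (Fin K)) q B := by
    simpa only [Fintype.card_sum, Fintype.card_fin] using h
  have hb := card_posRoots_le_of_pivotLaw_index h' e d J₁ P₁ hJ₁s hP₁p W₁ hW₁p
  unfold pivotPosRoots
  rw [← hcount]
  exact hb


/-- **Rows are antitone in the size** (iterated): `m ≤ m' → PivotRootLawAt m' K q B → PivotRootLawAt m K q B`. [folklore] -/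
theorem pivotRootLawAt_of_le_size {m m' K q B : ℕ} (hmm' : m ≤ m') (h : PivotRootLawAt m' K q B) :
    PivotRootLawAt m K q B := by
  obtain ⟨r, rfl⟩ := Nat.exists_eq_add_of_le hmm'
  induction r with
  | zero => simpa using h
  | succ r ih => exact ih (Nat.le_add_right m r) (pivotRootLawAt_of_succ_size (by simpa [Nat.add_assoc] using h))

end Summit.ValiantsHypothesis.ValiantsHypothesis.Theorems.LacunarySymmetroidMatrixDescartes.Pivot
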